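/-
Copyright (c) 2026 the pub-hodgecm-mathlib formalisation cell (harness21).  Prover seat hodgecm-mathlib-K2E2-p08 (g0),
Track B «K2-LIT» ∕ h413 (stmt-HodgeConjecture-24833), line K2_E2 «ThetaExhaustionByRigidity», unit «CLASS-TRANSPORT», file #8:
payment of the CLOSER socket `K2E2ThetaExhaustionByRigidity.ClassTransport.sig_K2E2TrFinComponentTransport` = tier-0
`StubFinComponentTransport` VERBATIM — FINITE-COMPONENT TRANSPORT TO A LINE WITH THE SAME FINITE CLASSES.  2026-09-03.
-/
import Summits.HodgeConjecture.HodgeConjecture.Theorems.F0P2cSocketC                               -- ★ (C♭) frame currency; ★ `F0P2cStubCI.rhoAtLine_chi_isIrreducible` (CI)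
import Summits.HodgeConjecture.HodgeConjecture.Theorems.H413LineClassTransportOfEquiv              -- ★ `LineClassTransport.rhoAtLine_lineClassTransport_of_equiv` ((C′) from the master equivalence)
import Literature.NumberTheory.Automorphic.Liu2021.Def411WeilCarriersAtLineClassTransportAllFrames -- ★ `Def411WeilCarriers.lineClassTransport_equiv` (the master equivalence, every rank ∕ frame)
import HarnessLib

/-!
# K2_E2 road (h413 = stmt-HodgeConjecture-24833), unit «CLASS-TRANSPORT», file #8 (CLOSER):
# an irreducible finite component embedding into Liu's carrier `ω_H(μ, a, χ)` makes `ω_H(μ, a′, χ)` a finite component whenever `locF a′ = locF a`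

Cell `pub/hodgecm-mathlib` (D-0151), Track B (21-frontier RULING «PUSH BOTH» 2026-09-03, director req621∕req624, chair K2-lead,
dealer K2E2-plan), socket module
`Summits/HodgeConjecture/HodgeConjecture/Cruxes/H413/Lines/K2_E2_ThetaExhaustionByRigidity_ClassTransport.lean` (planner K2E2-plan (g0),
sha16 c1718b627d06a747), socket **`sig_K2E2TrFinComponentTransport`** (SIGS TABLE row #8, CLOSER = tier-0 `StubFinComponentTransport` of
`Cruxes/H413/Lines/K2_E2_ThetaExhaustionByRigidity.lean` ED. 2 VERBATIM).  In the (C♭) TEL frame (`ιV` pinned by `g`): if the irreducible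
representation `σ` of `U(H)(𝔸_{L⁺,f})` is a finite component of the discrete automorphic `P` (★ `DiscreteAutomorphicRep.HasFinComponent`: an
injective intertwiner `σ ↪ P.finRep`) and embeds into Liu's carrier `ω_H(μ, a, χ) = rhoAtLine …[e₁] ιV a χ`, and the lines `a′, a ∈ (L⁺)ˣ` have
the same local norm classes at every finite place (`locF a′ = locF a`), then `ω_H(μ, a′, χ)` is a finite component of `P`.

THE MATHEMATICS (three compositions of injective intertwiners; [Liu2021, Def. 4.11–4.12, App. D Lem. D.1 (1)]; [GelbartRogawski1991, §3.1];
[Flath1979, §2]; [BorelJacquet1979, §4.6]).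
* `ω_H(μ, a, χ)` is IRREDUCIBLE at every pinned CM frame: ★ `F0P2cStubCI.rhoAtLine_chi_isIrreducible` (CI, closed unconditionally in tree).
* PROOF STRATEGY OF THIS FILE (differs from the TR-1 road «range of an injective map into an irreducible is `⊤`»): BOTH `σ` and `ω_H` are
  irreducible, so Mathlib's Schur dichotomy ★ `Representation.IsIrreducible.bijective_or_eq_zero` applies to the given injective intertwiner
  `f : σ → ω_H(μ, a, χ)`; the branch `f = 0` is absurd (an injective zero map forces the carrier space `W` of `σ` to be a subsingleton, whence
  `⊥ = ⊤` in `Subrepresentation σ`, contradicting `IsSimpleOrder`).  So `f` is an equivalence of representations (★ `IntertwiningMap.ofBijective`),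
  and its inverse `ω_H(μ, a, χ) ⥲ σ` composed with the finite-component witness `σ ↪ P.finRep` exhibits `ω_H(μ, a, χ)` as a finite component.
* The line-class transport (C′) — ★ `LineClassTransport.rhoAtLine_lineClassTransport_of_equiv` applied to the MASTER equivalence ★
  `Def411WeilCarriers.lineClassTransport_equiv` ([Liu2021, App. D §D.1 Step 1 footnote]: the class of `ω(μ, ε, χ)` depends on the line only
  through `ε = locF a`) — at the splitting character `χ_V := toHeckeCharacter L μ` and the pair `(a′, a)` gives an injective intertwiner
  `ω_H(μ, a′, χ) ↪ ω_H(μ, a, χ)` for the pulled-back actions along ANY `ιV`; precomposing finishes.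
No hypothesis is idle except those carried by the frozen socket for the frame (`ι, T, hT`, signature, `2 ≤ [L⁺:ℚ]`, which the tier-0 head
threads through every stub): irreducibility of `σ` is used (bijectivity), the pin `hιV` is used (CI), `locF a′ = locF a` is used ((C′)).

HONEST LABEL: HC_CM is proved only modulo the 7 printed citations (2 remaining named inputs: hLiu418 = stmt-HodgeConjecture-24832,
h413 = stmt-HodgeConjecture-24833) until rung 0 closes; this file is a `--supports stmt-HodgeConjecture-24833 --as helper` scaffold file of the
K2_E2 road (it re-ties tier-0 `stub_finComponentTransport` by `exact`) and retires nothing by itself.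

## References
* [Liu2021] Y. Liu, *Fourier–Jacobi cycles and arithmetic relative trace formula*, Camb. J. Math. 9 (2021) = arXiv:2102.11518: Def. 4.11
  (l. 2092–2096), Def. 4.12, App. D §D.1 Step 1 footnote (l. 5215), Lem. D.1 (1).
* [GelbartRogawski1991] S. Gelbart, J. Rogawski, Invent. Math. 105 (1991), §3.1 Prop. 3.1.1 p. 455, Remark p. 457.
* [Flath1979] D. Flath, *Decomposition of representations into tensor products*, Corvallis PSPM 33.1 (1979), §2.
* [BorelJacquet1979] A. Borel, H. Jacquet, *Automorphic forms and automorphic representations*, Corvallis PSPM 33.1 (1979), §4.6.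
-/

set_option autoImplicit false
-- the mandated namespace repeats the single-problem summit's segment (`HodgeConjecture.HodgeConjecture`)
set_option linter.dupNamespace false

noncomputable section

namespace Summit.HodgeConjecture.HodgeConjecture.Cruxes.H413.K2E2TrFinComponentTransport

open scoped TensorProduct Matrix ComplexOrder
open NumberField NumberField.InfinitePlace IsDedekindDomain MeasureTheory
open Literature.NumberTheory Literature.NumberTheory.Automorphic Literature.NumberTheory.Automorphic.UnitaryGroup
open Literature.NumberTheory.Automorphic.Liu2021
open Literature.NumberTheory.Automorphic.Liu2021.Def411WeilCarriers
open Literature.NumberTheory.Automorphic.Liu2021.Def411WeilCarriersDoubling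
open Literature.NumberTheory.Automorphic.IdeleClassGroup
open Literature.NumberTheory.GelbartRogawski1991 Literature.NumberTheory.GelbartRogawski1991.UnitaryDualPair
open Literature.NumberTheory.GelbartRogawski1991.UnitaryDualPair.WeilCoinv
open Literature.RepresentationTheory Literature.RepresentationTheory.Liu2021
open Summit.HodgeConjecture.CorCM
open Summit.HodgeConjecture.HodgeConjecture.Cruxes.H413

/-! ## §1  A Mathlib-only lemma: an injective intertwiner between irreducible representations is bijective -/

/-- **Schur dichotomy, injective case.**  An INJECTIVE intertwiner `f : σ → ρ` between two IRREDUCIBLE representations over a field is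
bijective: by Mathlib's ★ `Representation.IsIrreducible.bijective_or_eq_zero` it is bijective or zero, and an injective zero map would make
the space of `σ` a subsingleton, so that `⊥ = ⊤` in `Subrepresentation σ` — impossible in a simple order.
[cite: Liu2021, App. D Lem. D.1 (1)] [cite: BorelJacquet1979, §4.6] -/
theorem bijective_of_injective_of_isIrreducible
    {G : Type*} [Monoid G] {k : Type*} [Field k] {V W : Type*} [AddCommGroup V] [Module k V] [AddCommGroup W] [Module k W]
    {σ : Representation k G V} {ρ : Representation k G W} (hσ : σ.IsIrreducible) (hρ : ρ.IsIrreducible)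
    (f : σ.IntertwiningMap ρ) (hf : Function.Injective f) : Function.Bijective f := by
  rcases Representation.IsIrreducible.bijective_or_eq_zero f with h | h
  · exact h
  · exfalso
    have hV : Subsingleton V := ⟨fun x y => hf (by simp [h])⟩
    have hbt : (⊥ : Subrepresentation σ) = ⊤ := Subrepresentation.toSubmodule_injective (Subsingleton.elim _ _)
    exact bot_ne_top hbt

/-! ## §2  The head: payment of `sig_K2E2TrFinComponentTransport` (= tier-0 `StubFinComponentTransport`) TOKEN FOR TOKEN -/

set_option synthInstance.maxHeartbeats 400000 in
set_option maxHeartbeats 8000000 in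
/-- **PAYMENT OF `sig_K2E2TrFinComponentTransport`** (CLOSER socket #8 of unit «CLASS-TRANSPORT» of the K2_E2 road,
`Cruxes/H413/Lines/K2_E2_ThetaExhaustionByRigidity_ClassTransport.lean`; = tier-0 `StubFinComponentTransport` VERBATIM).
**Finite-component transport to a line with the same finite classes.**  In the (C♭) TEL frame (`ιV k = g_f⁻¹ k g_f`): if the irreducible `σ`
is a finite component of the discrete `P` and embeds into Liu's carrier `ω_H(μ, a, χ) = rhoAtLine …[e₁] ιV a χ`, and `locF a′ = locF a`, then
`ω_H(μ, a′, χ)` is a finite component of `P`.  Proof: `ω_H(μ, a, χ)` is irreducible (★ CI `F0P2cStubCI.rhoAtLine_chi_isIrreducible`), so the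
injective `f : σ ↪ ω_H(μ, a, χ)` is an equivalence (§1, Schur dichotomy); compose its inverse with the witness `σ ↪ P.finRep`, then precompose
the injective line-class transport `ω_H(μ, a′, χ) ↪ ω_H(μ, a, χ)` ((C′) = ★ `rhoAtLine_lineClassTransport_of_equiv` ∘ ★ `lineClassTransport_equiv`
at `χ_V := toHeckeCharacter L μ` and the pair `(a′, a)`).  The heartbeat options are those of the socket declaration itself (statement elaboration).
[cite: Liu2021, Def. 4.11 (l. 2092–2096); Def. 4.12; App. D Lem. D.1 (1); App. D §D.1 Step 1 footnote (l. 5215)]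
[cite: GelbartRogawski1991, §3.1 Prop. 3.1.1 p. 455] [cite: Flath1979, §2] [cite: BorelJacquet1979, §4.6] -/
theorem finComponentTransport :
    ∀ (L : Type) [Field L] [NumberField L] [IsCMField L] (ι : L →+* ℂ) (H : Matrix (Fin 3) (Fin 3) L) (T : GL (Fin 3) ℂ)
      (hT : (T : Matrix (Fin 3) (Fin 3) ℂ)ᴴ * H.map ι * (T : Matrix (Fin 3) (Fin 3) ℂ) = Literature.Geometry.ComplexHyperbolic.BallModel.J),
      (∀ τ' : L →+* ℂ, InfinitePlace.mk τ' ≠ InfinitePlace.mk ι → (H.map τ').PosDef) → 2 ≤ Module.finrank ℚ ↥(maximalRealSubfield L) →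
      ∀ {n' : ℕ} (e₁ : Fin 3 × Fin 1 ≃ Fin n') (dV : Fin 3 → L) (hdV : ∀ i, IsCMField.complexConj L (dV i) = dV i)
        (hdV0 : ∀ i, dV i ≠ 0) (g : GL (Fin 3) L)
        (hg : ((g : Matrix (Fin 3) (Fin 3) L).map (cmConjRingHom L))ᵀ * H * (g : Matrix (Fin 3) (Fin 3) L) = Matrix.diagonal dV)
        (ιV : finAdelic (↥(maximalRealSubfield L)) L (IsCMField.complexConj L) 3 H →*
            finAdelic (↥(maximalRealSubfield L)) L (IsCMField.complexConj L) 3 (Matrix.diagonal dV)),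
          (∀ k, ((ιV k : finAdelic (↥(maximalRealSubfield L)) L (IsCMField.complexConj L) 3 (Matrix.diagonal dV)) :
              GL (Fin 3) (FiniteAdeleRing (𝓞 L) L)) =
            (toFinAdeleGL L 3 g)⁻¹ * (k : GL (Fin 3) (FiniteAdeleRing (𝓞 L) L)) * toFinAdeleGL L 3 g) →
          ∀ (μA : Measure (adelicGroupData (↥(maximalRealSubfield L)) L (IsCMField.complexConj L) 3 H).automorphicQuotient)
            [(adelicGroupData (↥(maximalRealSubfield L)) L (IsCMField.complexConj L) 3 H).IsAutomorphicMeasure μA]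
            (W : Type) [AddCommGroup W] [Module ℂ W]
            (σ : Representation ℂ (finAdelic (↥(maximalRealSubfield L)) L (IsCMField.complexConj L) 3 H) W),
            σ.IsIrreducible →
          ∀ (P : DiscreteAutomorphicRep (adelicGroupData (↥(maximalRealSubfield L)) L (IsCMField.complexConj L) 3 H) μA)
            (μ : Literature.NumberTheory.Automorphic.IdeleClassGroup L →ₜ* Circle) (hμ : IsConjugateSymplectic L μ)
            (a a' : (↥(maximalRealSubfield L))ˣ) (χ : Chi (↥(maximalRealSubfield L)) L (IsCMField.complexConj L)),
            P.HasFinComponent σ →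
            (∃ f : σ.IntertwiningMap
                (rhoAtLine (↥(maximalRealSubfield L)) L (IsCMField.complexConj L) 3 e₁ (Matrix.diagonal dV)
                  (complexConj_imagUnit L) (imagUnit_ne_zero L) (imagUnit_mul_self L) (realDiagonal_isSymm L dV hdV)
                  (isUnit_det_realDiagonal L dV hdV hdV0) (realDiagonal_map L dV hdV).symm
                  (fun a => isCompatible_chiSplittingLine L e₁ dV hdV hdV0 (toHeckeCharacter L μ)
                    (isUnitary_toHeckeCharacter L μ) ((isOscillatorChar_toHeckeCharacter_iff μ).mpr hμ)
                    (TW (↥(maximalRealSubfield L)) a) (isSymm_TW (↥(maximalRealSubfield L)) a)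
                    (isUnit_det_TW (↥(maximalRealSubfield L)) a) (JW (↥(maximalRealSubfield L)) L a)
                    (JW_eq (↥(maximalRealSubfield L)) L a)) ιV a χ),
              Function.Injective f) →
            locF (↥(maximalRealSubfield L)) (imagUnitSq L) a' = locF (↥(maximalRealSubfield L)) (imagUnitSq L) a →
            P.HasFinComponent
              (rhoAtLine (↥(maximalRealSubfield L)) L (IsCMField.complexConj L) 3 e₁ (Matrix.diagonal dV)
                (complexConj_imagUnit L) (imagUnit_ne_zero L) (imagUnit_mul_self L) (realDiagonal_isSymm L dV hdV)
                (isUnit_det_realDiagonal L dV hdV hdV0) (realDiagonal_map L dV hdV).symm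
                (fun a => isCompatible_chiSplittingLine L e₁ dV hdV hdV0 (toHeckeCharacter L μ)
                  (isUnitary_toHeckeCharacter L μ) ((isOscillatorChar_toHeckeCharacter_iff μ).mpr hμ)
                  (TW (↥(maximalRealSubfield L)) a) (isSymm_TW (↥(maximalRealSubfield L)) a)
                  (isUnit_det_TW (↥(maximalRealSubfield L)) a) (JW (↥(maximalRealSubfield L)) L a)
                  (JW_eq (↥(maximalRealSubfield L)) L a)) ιV a' χ) := by
  intro L _ _ _ ι H T hT _hpos _hrk n' e₁ dV hdV hdV0 g hg ιV hιV μA _ W _ _ σ hσ P μ hμ a a' χ hfin hf hloc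
  -- CI: Liu's carrier at the line `a` is irreducible in the pinned frame
  have hirr := F0P2cStubCI.rhoAtLine_chi_isIrreducible L H e₁ dV hdV hdV0 g hg ιV hιV μ hμ a χ
  obtain ⟨i, hi⟩ := hfin
  obtain ⟨f, hfinj⟩ := hf
  -- Schur: the injective intertwiner `σ ↪ ω_H(μ, a, χ)` between irreducibles is an equivalence
  have hbij : Function.Bijective f := bijective_of_injective_of_isIrreducible hσ hirr f hfinj
  -- (C′): the line-class transport `ω_H(μ, a′, χ) ↪ ω_H(μ, a, χ)` along `ιV`
  obtain ⟨t, ht⟩ :=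
    LineClassTransport.rhoAtLine_lineClassTransport_of_equiv lineClassTransport_equiv L e₁ dV hdV hdV0
      (toHeckeCharacter L μ) (isUnitary_toHeckeCharacter L μ) ((isOscillatorChar_toHeckeCharacter_iff μ).mpr hμ) ιV χ a' a hloc
  refine ⟨(i.comp (f.ofBijective hbij).symm.toIntertwiningMap).comp t, ?_⟩
  exact hi.comp ((f.ofBijective hbij).symm.injective.comp ht)

end Summit.HodgeConjecture.HodgeConjecture.Cruxes.H413.K2E2TrFinComponentTransport

end
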